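import Literature.AnabelianGeometry.EtaleTheta.ThetaSettingToZHat
import Literature.AnabelianGeometry.EtaleTheta.SettingModelTateTheta
import Literature.AnabelianGeometry.EtaleTheta.SettingModelChiTheta
import HarnessLib

/-!
# [EtTh] Rmk. 1.6.4 «so `Π_X/Π_{Y^∧} ≅ Ẑ`» COMPUTED at the semi-synthetic models of record:
# `toZHat = ê ∘ pr_{F̂₂}`, `Π_{Y^∧} = (Ker ê) ⋊ G_{ℚ_p}`, and the `Ẑ`-quotient is the `a`-exponent coordinate

S. Mochizuki, *The Étale Theta Function …* [EtTh], Publ. RIMS **45** (2009), §1, PDF p. 12 (PRIMS p. 238): "a natural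
surjection `Π^tp_X ↠ Z` whose kernel, which we denote by `Π^tp_Y`"; "`Π_X = (Π^tp_X)^∧`" [cite: MochizukiEtTh2009, §1 p.12];
Remark 1.6.4, PDF p. 26 (PRIMS p. 252): "the profinite étale coverings determined by the tempered coverings
`Ÿ^log → Y^log → X^log` [so `Π_X/Π_{Y^∧} ≅ Ẑ`]" [cite: MochizukiEtTh2009, Rmk 1.6.4 p.26].

Layer L2 of the abc-iut cell, seat abc-iut-L2-t12 gen 12, row «TOZHAT@MODELχq» (the model-side candidate named by
abc-iut-L2-lead gen 9 in R1348 for abc-iut-f-142's row «TOZHAT», `ThetaSettingToZHat.lean` p511642).  PROOF-ONLY.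

abc-iut-f-142's `ThetaSetting.toZHat : Π_X →ₜ* Ẑ` is THE continuous extension of `η ∘ toZ` along the profinite
completion `toHat`, with `ker_toZHat : Ker toZHat = Π_{Y^∧} := cl toHat(Π^tp_Y)` and `quotientGtpYHatEquivZHat :
Π_X ⧸ Π_{Y^∧} ≃* Ẑ`.  Here these three objects are EVALUATED at the cell's semi-synthetic models of record, where
`Π_X = F̂₂ ⋊ G_{ℚ_p}` and `Π^tp_X = (F̂₂ ×_Ẑ ℤ) ⋊ G_{ℚ_p}` (abc-iut-w5-d249's `PiHtχq` / `PiTpχq`, abc-iut-L2-t1's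
`PiHtχ` / `PiTpχ`) and `toZ = pr₂ ∘ left` (`GfpTwistData₀.toZ_apply`):

* §0 (generic, any `ThetaSetting`): a continuous homomorphism `Φ : Π_X → Ẑ` with `Φ ∘ toHat = η ∘ toZ` IS `toZHat`
  (`toZHat_unique`), so `Π_{Y^∧} = Ker Φ` and `[z] ↦ Φ z` is the isomorphism of the bracket;
* §1 (the TATE DATUM OF RECORD `modelχq p i j`, every `i`, every even `j` — so also `modelTate := modelχq p 1 2`):
  **`toZHat_modelχq_apply : toZHat g = ê g.left`** (`ê = SettingModel.eHat : F̂₂ →ₜ* Ẑ` the completed `a`-exponent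
  sum; `ê ∘ left` is a homomorphism by `eHat_actHatχq` and extends `η ∘ toZ` by the fibre-product law `mem_Gfp`),
  **`mem_gtpYHat_modelχq_iff : g ∈ Π_{Y^∧} ↔ ê g.left = 1`**, `gtpYHat_modelχq_eq : Π_{Y^∧} = (Ker ê) ⋊ G_{ℚ_p}`,
  `quotientGtpYHatEquivZHat_modelχq_mk : [g] ↦ ê g.left`;
* §2: the same at the stage-1 χ-model `modelχ p` (`eHat_twist`).

HONEST LABEL: SEMI-SYNTHETIC models (consistency evidence for OUR typed interfaces, NOT tempered fundamental groups
of curves); computed-at-a-model ≠ proved in print; nothing of [EtTh] Rmk. 1.6.4 beyond its bracket is touched; no side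
is taken on [IUTchIII] Cor. 3.12; nothing here asserts that abc is proved or refuted; typed ≠ proved.  PROOF-ONLY
(0 `def`s, 0 `instance`s, no notation, no `Prop`-fact).
-/

noncomputable section

namespace Literature.AnabelianGeometry.EtaleTheta

open Topology
open Literature.AnabelianGeometry.SemiGraphs SettingModel

namespace ThetaSetting

/-! ### §0. Generic: a continuous extension of `η ∘ toZ` computes `toZHat`, `Π_{Y^∧}` and the bracket -/

section Generic

variable {p : ℕ} [Fact p.Prime] (D : ThetaSetting p)

/-- **Any continuous homomorphism `Φ : Π_X → Ẑ` with `Φ ∘ toHat = η ∘ toZ` IS `toZHat`** (pointwise form of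
abc-iut-f-142's `toZHat_unique`). [cite: MochizukiEtTh2009, Rmk 1.6.4 p.26] -/
theorem toZHat_apply_of_extends (Φ : D.PiHat →ₜ* ZHat) (h : ∀ g : D.PiTemp, Φ (D.toHat g) = etaZ (D.toZ g))
    (z : D.PiHat) : D.toZHat z = Φ z := by
  rw [← D.toZHat_unique Φ h]

/-- `Π_{Y^∧} = Ker Φ` for any such `Φ` (abc-iut-f-142's `ker_toZHat`). [cite: MochizukiEtTh2009, Rmk 1.6.4 p.26] -/
theorem mem_gtpYHat_iff_of_extends (Φ : D.PiHat →ₜ* ZHat) (h : ∀ g : D.PiTemp, Φ (D.toHat g) = etaZ (D.toZ g))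
    (z : D.PiHat) : z ∈ D.GtpYHat ↔ Φ z = 1 := by
  rw [← D.ker_toZHat, MonoidHom.mem_ker]
  change D.toZHat z = 1 ↔ _
  rw [D.toZHat_apply_of_extends Φ h]

/-- `Π_{Y^∧} = Ker Φ` as subgroups. [cite: MochizukiEtTh2009, Rmk 1.6.4 p.26] -/
theorem gtpYHat_eq_ker_of_extends (Φ : D.PiHat →ₜ* ZHat) (h : ∀ g : D.PiTemp, Φ (D.toHat g) = etaZ (D.toZ g)) :
    D.GtpYHat = Φ.toMonoidHom.ker := by
  ext z
  rw [D.mem_gtpYHat_iff_of_extends Φ h, MonoidHom.mem_ker]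
  rfl

/-- The bracket `Π_X ⧸ Π_{Y^∧} ≃* Ẑ` on cosets is `[z] ↦ Φ z` for any such `Φ`. [cite: MochizukiEtTh2009, Rmk 1.6.4 p.26] -/
theorem quotientGtpYHatEquivZHat_mk_of_extends [D.GtpYHat.Normal] (Φ : D.PiHat →ₜ* ZHat)
    (h : ∀ g : D.PiTemp, Φ (D.toHat g) = etaZ (D.toZ g)) (z : D.PiHat) :
    D.quotientGtpYHatEquivZHat (QuotientGroup.mk z) = Φ z := by
  rw [quotientGtpYHatEquivZHat_mk, D.toZHat_apply_of_extends Φ h]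

/-- `η : ℤ → Ẑ` of abc-iut-f-142 (`etaZ`) IS the models' `ι : ℤ → Ẑ` (`SettingModel.iotaZ`), by `rfl`.
[cite: MochizukiEtTh2009, Rmk 1.6.4 p.26] -/
theorem etaZ_apply_eq_iotaZ (n : Multiplicative ℤ) : etaZ n = iotaZ n := rfl

end Generic

/-! ### §1. The Tate datum of record `modelχq p i j` (`Π_X = F̂₂ ⋊_{(κ_p^i, κ_p^j, χ)} G_{ℚ_p}`) -/

section Modelχq

variable (p : ℕ) [Fact p.Prime] (i j : ℤ) (hj : Even j)

/-- `ê ∘ left : Π_X = F̂₂ ⋊ G_{ℚ_p} → Ẑ` is a continuous homomorphism extending `η ∘ toZ` at the stage-2 model — the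
two facts `toZHat_unique` needs: a homomorphism because the stage-2 action fixes `ê` (`eHat_actHatχq`), extending
`η ∘ (pr₂ ∘ left)` because `ê(pr₁ γ) = ι(pr₂ γ)` on `Γ = F̂₂ ×_Ẑ ℤ` (`mem_Gfp`). [cite: MochizukiEtTh2009, §1 p.12] -/
theorem exists_extends_modelχq : ∃ Φ : PiHtχq p i j →ₜ* ZHat, (∀ z, Φ z = eHat z.left) ∧
    ∀ g : PiTpχq p i j, Φ (toHatχq p i j g) = etaZ ((ThetaSetting.modelχq p i j hj).toZ g) := by
  refine ⟨{ toMonoidHom := Semidirect.leftHom eHat.toMonoidHom (fun σ x => eHat_actHatχq p i j σ x)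
            continuous_toFun := eHat.continuous.comp (Semidirect.continuous_left (isInducing_leftRightHatχq p i j)) },
    fun _ => rfl, fun g => ?_⟩
  change eHat (gfpFst g.left) = iotaZ (gfpSnd g.left)
  exact (mem_Gfp _).mp g.left.2

/-- **`toZHat` at the Tate datum of record is the completed `a`-exponent sum on the `F̂₂`-coordinate**:
`(modelχq p i j).toZHat g = ê g.left` (every `i`, every even `j`). [cite: MochizukiEtTh2009, Rmk 1.6.4 p.26] -/
theorem toZHat_modelχq_apply (g : PiHtχq p i j) : (ThetaSetting.modelχq p i j hj).toZHat g = eHat g.left := by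
  obtain ⟨Φ, hΦ, hext⟩ := exists_extends_modelχq p i j hj
  rw [← hΦ g]
  exact (ThetaSetting.modelχq p i j hj).toZHat_apply_of_extends Φ hext g

/-- On the geometric factor: `toZHat (inl x) = ê x`. [cite: MochizukiEtTh2009, Rmk 1.6.4 p.26] -/
theorem toZHat_modelχq_inl (x : F₂hatT) :
    (ThetaSetting.modelχq p i j hj).toZHat (SemidirectProduct.inl x) = eHat x := by
  rw [toZHat_modelχq_apply, SemidirectProduct.left_inl]

/-- On the arithmetic factor: `toZHat (inr σ) = 1` (`G_{ℚ_p}` maps into `Π_{Y^∧}`). [cite: MochizukiEtTh2009, Rmk 1.6.4 p.26] -/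
theorem toZHat_modelχq_inr (σ : GQp p) :
    (ThetaSetting.modelχq p i j hj).toZHat (SemidirectProduct.inr σ) = 1 := by
  rw [toZHat_modelχq_apply, SemidirectProduct.left_inr, map_one]

/-- On the generator `η(a) ∈ F̂₂`: `toZHat (inl (η a)) = ι 1` — the completed quotient is ONTO the dense `ι(ℤ)` by an
explicit element (non-vacuity of `toZHat_surjective` at the model). [cite: MochizukiEtTh2009, Rmk 1.6.4 p.26] -/
theorem toZHat_modelχq_inl_eta_a :
    (ThetaSetting.modelχq p i j hj).toZHat (SemidirectProduct.inl (eta (FreeGroup.of 0))) = iotaZ (Multiplicative.ofAdd 1) := by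
  rw [toZHat_modelχq_inl, eHat_eta, expA_apply, heisHom_of_zero]

/-- **`Π_{Y^∧}` at the Tate datum of record: `g ∈ Π_{Y^∧} ↔ ê g.left = 1`** — the closure of `toHat(Π^tp_Y)` in
`Π_X = F̂₂ ⋊ G_{ℚ_p}` is cut out by the completed `a`-exponent sum (abc-iut-f-142's `ker_toZHat`, evaluated).
[cite: MochizukiEtTh2009, Rmk 1.6.4 p.26] -/
theorem mem_gtpYHat_modelχq_iff (g : PiHtχq p i j) :
    g ∈ (ThetaSetting.modelχq p i j hj).GtpYHat ↔ eHat g.left = 1 := by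
  obtain ⟨Φ, hΦ, hext⟩ := exists_extends_modelχq p i j hj
  rw [(ThetaSetting.modelχq p i j hj).mem_gtpYHat_iff_of_extends Φ hext g, hΦ g]

/-- **`Π_{Y^∧} = (Ker ê) ⋊ G_{ℚ_p}`** as a subgroup of `F̂₂ ⋊ G_{ℚ_p}` (abc-iut-L2-t1's `Semidirect.twistedProd`; `Ker ê` is
stable under the stage-2 action by `eHat_actHatχq`). [cite: MochizukiEtTh2009, Rmk 1.6.4 p.26] -/
theorem gtpYHat_modelχq_eq : (ThetaSetting.modelχq p i j hj).GtpYHat =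
    Semidirect.twistedProd eHat.toMonoidHom.ker ⊤
      (Semidirect.stable_ker eHat.toMonoidHom (fun σ x => eHat_actHatχq p i j σ x) ⊤) := by
  ext g
  rw [mem_gtpYHat_modelχq_iff, Semidirect.mem_twistedProd, MonoidHom.mem_ker]
  exact ⟨fun h => ⟨h, Subgroup.mem_top _⟩, fun h => h.1⟩

/-- `inr(G_{ℚ_p}) ⊆ Π_{Y^∧}` at the model. [cite: MochizukiEtTh2009, Rmk 1.6.4 p.26] -/
theorem inr_mem_gtpYHat_modelχq (σ : GQp p) :
    (SemidirectProduct.inr σ : PiHtχq p i j) ∈ (ThetaSetting.modelχq p i j hj).GtpYHat := by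
  rw [mem_gtpYHat_modelχq_iff, SemidirectProduct.left_inr, map_one]

/-- `inl x ∈ Π_{Y^∧} ↔ ê x = 1`: on the geometric factor `Π_{Y^∧} ∩ Δ_X = Ker ê = Δ_{Y^∧}`. [cite: MochizukiEtTh2009, Rmk 1.6.4 p.26] -/
theorem inl_mem_gtpYHat_modelχq_iff (x : F₂hatT) :
    (SemidirectProduct.inl x : PiHtχq p i j) ∈ (ThetaSetting.modelχq p i j hj).GtpYHat ↔ eHat x = 1 := by
  rw [mem_gtpYHat_modelχq_iff, SemidirectProduct.left_inl]

/-- The generator is NOT in `Π_{Y^∧}`: `inl (η a) ∉ Π_{Y^∧}` (`ê(η a) = ι 1 ≠ 1`) — `Π_{Y^∧} ≠ Π_X` at the model.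
[cite: MochizukiEtTh2009, Rmk 1.6.4 p.26] -/
theorem inl_eta_a_not_mem_gtpYHat_modelχq :
    (SemidirectProduct.inl (eta (FreeGroup.of 0)) : PiHtχq p i j) ∉ (ThetaSetting.modelχq p i j hj).GtpYHat := by
  rw [inl_mem_gtpYHat_modelχq_iff, eHat_eta, expA_apply, heisHom_of_zero, ← map_one iotaZ]
  intro h
  have h1 := iotaZ_injective h
  simp at h1

/-- **Print's bracket «`Π_X/Π_{Y^∧} ≅ Ẑ`» READ OFF at the Tate datum of record**: the isomorphism of abc-iut-f-142's
`quotientGtpYHatEquivZHat` is `[g] ↦ ê g.left`, the `a`-exponent coordinate. [cite: MochizukiEtTh2009, Rmk 1.6.4 p.26] -/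
theorem quotientGtpYHatEquivZHat_modelχq_mk [(ThetaSetting.modelχq p i j hj).GtpYHat.Normal] (g : PiHtχq p i j) :
    (ThetaSetting.modelχq p i j hj).quotientGtpYHatEquivZHat (QuotientGroup.mk g) = eHat g.left := by
  rw [quotientGtpYHatEquivZHat_mk, toZHat_modelχq_apply]

end Modelχq

/-! ### §2. The stage-1 χ-model `modelχ p` (`Π_X = F̂₂ ⋊_χ G_{ℚ_p}`) -/

section Modelχ

variable (p : ℕ) [Fact p.Prime]

/-- `ê ∘ left` is a continuous homomorphism `F̂₂ ⋊_χ G_{ℚ_p} → Ẑ` extending `η ∘ toZ` at the χ-model (`eHat_twist`,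
`mem_Gfp`). [cite: MochizukiEtTh2009, §1 p.12] -/
theorem exists_extends_modelχ : ∃ Φ : PiHtχ p →ₜ* ZHat, (∀ z, Φ z = eHat z.left) ∧
    ∀ g : PiTpχ p, Φ (toHatχ p g) = etaZ ((ThetaSetting.modelχ p).toZ g) := by
  refine ⟨{ toMonoidHom := Semidirect.leftHom eHat.toMonoidHom (fun σ x => by
              rw [actHatχ_apply]; exact eHat_twist _ x)
            continuous_toFun := eHat.continuous.comp (Semidirect.continuous_left (isInducing_leftRightHatχ p)) },
    fun _ => rfl, fun g => ?_⟩
  change eHat (gfpFst g.left) = iotaZ (gfpSnd g.left)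
  exact (mem_Gfp _).mp g.left.2

/-- **`(modelχ p).toZHat g = ê g.left`.** [cite: MochizukiEtTh2009, Rmk 1.6.4 p.26] -/
theorem toZHat_modelχ_apply (g : PiHtχ p) : (ThetaSetting.modelχ p).toZHat g = eHat g.left := by
  obtain ⟨Φ, hΦ, hext⟩ := exists_extends_modelχ p
  rw [← hΦ g]
  exact (ThetaSetting.modelχ p).toZHat_apply_of_extends Φ hext g

/-- **`g ∈ Π_{Y^∧} ↔ ê g.left = 1`** at the χ-model. [cite: MochizukiEtTh2009, Rmk 1.6.4 p.26] -/
theorem mem_gtpYHat_modelχ_iff (g : PiHtχ p) : g ∈ (ThetaSetting.modelχ p).GtpYHat ↔ eHat g.left = 1 := by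
  obtain ⟨Φ, hΦ, hext⟩ := exists_extends_modelχ p
  rw [(ThetaSetting.modelχ p).mem_gtpYHat_iff_of_extends Φ hext g, hΦ g]

/-- `Π_{Y^∧} = (Ker ê) ⋊_χ G_{ℚ_p}` at the χ-model. [cite: MochizukiEtTh2009, Rmk 1.6.4 p.26] -/
theorem gtpYHat_modelχ_eq : (ThetaSetting.modelχ p).GtpYHat =
    Semidirect.twistedProd eHat.toMonoidHom.ker ⊤
      (Semidirect.stable_ker eHat.toMonoidHom (fun σ x => by rw [actHatχ_apply]; exact eHat_twist _ x) ⊤) := by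
  ext g
  rw [mem_gtpYHat_modelχ_iff, Semidirect.mem_twistedProd, MonoidHom.mem_ker]
  exact ⟨fun h => ⟨h, Subgroup.mem_top _⟩, fun h => h.1⟩

/-- The bracket at the χ-model: `[g] ↦ ê g.left`. [cite: MochizukiEtTh2009, Rmk 1.6.4 p.26] -/
theorem quotientGtpYHatEquivZHat_modelχ_mk [(ThetaSetting.modelχ p).GtpYHat.Normal] (g : PiHtχ p) :
    (ThetaSetting.modelχ p).quotientGtpYHatEquivZHat (QuotientGroup.mk g) = eHat g.left := by
  rw [quotientGtpYHatEquivZHat_mk, toZHat_modelχ_apply]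

end Modelχ

end ThetaSetting

end Literature.AnabelianGeometry.EtaleTheta

end
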